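import Summits.ResolutionOfSingularities.ResolutionOfSingularities.Theorems.WildConesClassicalRegimesDefs
import Summits.ResolutionOfSingularities.ResolutionOfSingularities.Theorems.WildConesClassicalRegimesStubHighOrdNotIsol
import Summits.ResolutionOfSingularities.ResolutionOfSingularities.Theorems.WildConesClassicalRegimesStubOrdPExitSurface
import Mathlib
import Literature.RingTheory.MvPowerSeries.PartialDerivative

/-!
# Route `WildCones`, crux `ClassicalRegimes` (stmt-ResolutionOfSingularities-16884), line `milnor-descent`:
# stub `stub_caseAExitOrdSucc` — Case A exit at cleaned order `p + 1`, `n ≥ 3`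

The point-blow-up dynamics of `z^p = a(u₁, …, uₙ)` over a perfect field of characteristic `p`
(`Theorems/WildConesClassicalRegimesDefs.lean`: `clean`, `bl`, `dv`, `tr`, `step`, `ser`, `pd`, `jac`,
`Isol`, `MultP`, `OrdP`, `OrdPSucc`). This file proves the stub `stub_caseAExitOrdSucc` of the line's
skeleton: in `n ≥ 3` variables, if the cleaned state `a = clean c` has multiplicity `p` but no monomial
of degree `p` (cleaned order `≥ p + 1`), then a successor `b = step i τ c` that is ISOLATED is NOT of
multiplicity `p`.

Argument. `MultP c` makes the division exponent `p`; every coefficient of `b` sits at an exponent `B`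
with `B i ≥ 1` (blow-up in chart `u_i` followed by division by `u_i^p` turns total degree `≥ p + 1`
into `u_i`-degree `≥ 1`; translation along the exceptional divisor and cleaning do not touch the
`u_i`-exponent — the bookkeeping of the sibling stub files
`Theorems/WildConesClassicalRegimesStub{OrdPExitSurface,HighOrdNotIsol}.lean` is reused). So
`f = ser b = u_i · F`, and by the LEIBNIZ rule
(`Literature.RingTheory.MvPowerSeries.pd_mul`; the hand-rolled `pd` has the same coefficients) the
Jacobian ideal `(∂f)` lies in `(u_i, F)`, whence `κ[[u]] ⧸ (u_i, F)` is finite over `κ`. Multiplicity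
`p` of `b` would kill the monomial `u_i` of `f`, i.e. `F(0) = 0`. But for `n ≥ 3` and `F(0) = 0` the
quotient `κ[[u]] ⧸ (u_i, F)` is infinite over `κ`: finiteness puts a power of every variable into the
ideal (a linear relation among `1, u_v, u_v², …` is `u_v^r · unit`); killing `u_i` by the substitution
`u_i ↦ 0` exhibits `G = F(u_i := 0)`, still without constant term, as a common divisor of `u_j^r` and
`u_l^t` for two further distinct variables, and distinct variables are coprime in the domain `κ[[u]]`,
so `G` would be a unit. Standard commutative algebra; no published source needed. [folklore]
-/

noncomputable section

set_option linter.dupNamespace false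

open scoped BigOperators Classical

namespace Summit.ResolutionOfSingularities.ResolutionOfSingularities.Theorems.WildCones

namespace CaseAExitOrdSucc

open MvPowerSeries

variable {p n : ℕ} {κ : Type} [Field κ]

/-! ### Bookkeeping on the coefficient calculus
(`MultP c ⇒` division exponent `p`, and the support lemmas for `dv ∘ bl` and `tr`, are reused from the
sibling stub files `…StubOrdPExitSurface.lean` and `…StubHighOrdNotIsol.lean`.) -/

/-- Cleaning is idempotent. [folklore] -/
theorem clean_clean (c : (Fin n → ℕ) → κ) : clean p n κ (clean p n κ c) = clean p n κ c := by
  funext A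
  unfold clean
  split_ifs <;> rfl

/-- The hand-rolled `pd` is the Literature partial derivative (same coefficient formula). [folklore] -/
theorem pd_eq (l : Fin n) (f : MvPowerSeries (Fin n) κ) :
    pd n κ l f = Literature.RingTheory.MvPowerSeries.pd l f := by
  ext A
  rfl

/-! ### Algebra in `κ[[u₁, …, uₙ]]` -/

/-- `u_l^t · φ` has at `m + t·e_l` the coefficient of `φ` at `m`. [folklore] -/
theorem coeff_add_single_X_pow_mul (l : Fin n) (t : ℕ) (φ : MvPowerSeries (Fin n) κ)
    (m : Fin n →₀ ℕ) : coeff (m + Finsupp.single l t) (X l ^ t * φ) = coeff m φ := by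
  rw [X_pow_eq, add_comm, coeff_add_monomial_mul, one_mul]

/-- The coefficient of `u_i · F` at `u_i` is the constant coefficient of `F`. [folklore] -/
theorem coeff_single_X_mul (i : Fin n) (F : MvPowerSeries (Fin n) κ) :
    coeff (Finsupp.single i 1) (X i * F) = constantCoeff F := by
  rw [← coeff_zero_eq_constantCoeff_apply, ← coeff_add_single_X_pow_mul i 1 F 0, zero_add, pow_one]

/-- COPRIMALITY of distinct variables: if `u_j^r = b₁ G` and `u_l^t = b₂ G` with `j ≠ l`, then `G`
is a unit. [folklore] -/
theorem isUnit_of_X_pow_eq_mul {j l : Fin n} (hjl : j ≠ l) {r t : ℕ}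
    {G b₁ b₂ : MvPowerSeries (Fin n) κ} (hj : (X j : MvPowerSeries (Fin n) κ) ^ r = b₁ * G)
    (hl : (X l : MvPowerSeries (Fin n) κ) ^ t = b₂ * G) : IsUnit G := by
  have hX : (X j : MvPowerSeries (Fin n) κ) ^ r ≠ 0 := fun h => by
    have := congrArg (coeff (Finsupp.single j r)) h
    rw [coeff_X_pow, if_pos rfl, map_zero] at this
    exact one_ne_zero this
  -- `u_j^r ∣ u_l^t · b₁`, hence `u_j^r ∣ b₁`
  have hdvd : (X j : MvPowerSeries (Fin n) κ) ^ r ∣ X l ^ t * b₁ := ⟨b₂, by rw [hl, hj]; ring⟩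
  have hdvd' : (X j : MvPowerSeries (Fin n) κ) ^ r ∣ b₁ := by
    rw [X_pow_dvd_iff] at hdvd ⊢
    intro m hm
    rw [← coeff_add_single_X_pow_mul l t b₁ m]
    apply hdvd
    rw [Finsupp.add_apply, Finsupp.single_eq_of_ne hjl, add_zero]
    exact hm
  obtain ⟨e, he⟩ := hdvd'
  have h1 : (X j : MvPowerSeries (Fin n) κ) ^ r * (e * G) = X j ^ r * 1 := by
    rw [mul_one, ← mul_assoc, ← he, ← hj]
  have h2 : e * G = 1 := by
    have h3 : (X j : MvPowerSeries (Fin n) κ) ^ r * (e * G - 1) = 0 := by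
      rw [mul_sub, h1, sub_self]
    rcases mul_eq_zero.mp h3 with h | h
    · exact absurd h hX
    · exact sub_eq_zero.mp h
  exact IsUnit.of_mul_eq_one e (by rw [mul_comm]; exact h2)

/-- FINITENESS FORCES MONOMIALS: if `κ[[u]] ⧸ I` is finite over `κ`, every variable has a power in
`I` (a linear relation among the classes of `1, u_v, u_v², …` is `u_v^r · unit ∈ I`). [folklore] -/
theorem exists_X_pow_mem (I : Ideal (MvPowerSeries (Fin n) κ))
    [Module.Finite κ (MvPowerSeries (Fin n) κ ⧸ I)] (v : Fin n) :
    ∃ r : ℕ, (X v : MvPowerSeries (Fin n) κ) ^ r ∈ I := by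
  have hdep := Module.Finite.not_linearIndependent_of_infinite (R := κ)
    (fun k : ℕ => Ideal.Quotient.mk I ((X v : MvPowerSeries (Fin n) κ) ^ k))
  rw [not_linearIndependent_iff] at hdep
  obtain ⟨s, g, hsum, k₀, hk₀, hg₀⟩ := hdep
  -- the relation, lifted to `κ[[u]]`
  have hPI : (∑ k ∈ s, g k • (X v : MvPowerSeries (Fin n) κ) ^ k) ∈ I := by
    rw [← Ideal.Quotient.eq_zero_iff_mem, ← Ideal.Quotient.mkₐ_eq_mk κ, map_sum]
    simpa only [map_smul, Ideal.Quotient.mkₐ_eq_mk] using hsum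
  have hcoeff : ∀ m : Fin n →₀ ℕ, coeff m (∑ k ∈ s, g k • (X v : MvPowerSeries (Fin n) κ) ^ k) =
      ∑ k ∈ s, if m = Finsupp.single v k then g k else 0 := by
    intro m
    rw [map_sum]
    refine Finset.sum_congr rfl fun k _ => ?_
    rw [map_smul, coeff_X_pow, smul_eq_mul, mul_ite, mul_one, mul_zero]
  generalize (∑ k ∈ s, g k • (X v : MvPowerSeries (Fin n) κ) ^ k) = P at hPI hcoeff
  -- the least exponent carrying a non-zero scalar
  have hex : ∃ k, k ∈ s ∧ g k ≠ 0 := ⟨k₀, hk₀, hg₀⟩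
  obtain ⟨hrs, hgr⟩ := Nat.find_spec hex
  have hmin : ∀ k ∈ s, k < Nat.find hex → g k = 0 := fun k hk hkr => by
    by_contra hne
    exact Nat.find_min hex hkr ⟨hk, hne⟩
  -- `u_v^r ∣ P`
  have hdvd : (X v : MvPowerSeries (Fin n) κ) ^ Nat.find hex ∣ P := by
    rw [X_pow_dvd_iff]
    intro m hm
    rw [hcoeff]
    refine Finset.sum_eq_zero fun k hk => ?_
    split_ifs with hmk
    · apply hmin k hk
      rw [hmk, Finsupp.single_eq_same] at hm
      exact hm
    · rfl
  obtain ⟨w, hw⟩ := hdvd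
  -- the cofactor is a unit: its constant coefficient is `g r ≠ 0`
  have hw0 : constantCoeff w = g (Nat.find hex) := by
    have h1 : coeff (Finsupp.single v (Nat.find hex) + 0) P = coeff 0 w := by
      rw [hw, X_pow_eq, coeff_add_monomial_mul, one_mul]
    rw [add_zero, hcoeff, Finset.sum_eq_single (Nat.find hex), if_pos rfl] at h1
    · rw [← coeff_zero_eq_constantCoeff_apply, ← h1]
    · intro k _ hkr
      rw [if_neg]
      intro h
      exact hkr ((Finsupp.single_injective v) h).symm
    · intro h
      exact absurd hrs h
  have hwu : IsUnit w := by
    rw [isUnit_iff_constantCoeff, hw0]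
    exact isUnit_iff_ne_zero.mpr hgr
  obtain ⟨u, rfl⟩ := hwu
  refine ⟨Nat.find hex, ?_⟩
  have : (X v : MvPowerSeries (Fin n) κ) ^ Nat.find hex = P * ↑u⁻¹ := by
    rw [hw, Units.mul_inv_cancel_right]
  rw [this]
  exact I.mul_mem_right _ hPI

/-- The substitution killing `u_i` (`u_i ↦ 0`, `u_m ↦ u_m`) is legitimate. [folklore] -/
theorem hasSubst_kill (i : Fin n) :
    HasSubst (fun m : Fin n => if m = i then (0 : MvPowerSeries (Fin n) κ) else X m) :=
  -- adapted from Literature.AlgebraicGeometry.Resolution.PlaneGermBlowupCalculus.hasSubst_kill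
  hasSubst_of_constantCoeff_zero fun m => by
    by_cases h : m = i <;> simp [h, constantCoeff_X]

/-- NON-FINITENESS: for `n ≥ 3` and `F` without constant term, `κ[[u]] ⧸ (u_i, F)` is not finite
over `κ`. [folklore] -/
theorem not_finite_quotient_span_pair (hn : 3 ≤ n) (i : Fin n) {F : MvPowerSeries (Fin n) κ}
    (hF : constantCoeff F = 0) :
    ¬ Module.Finite κ (MvPowerSeries (Fin n) κ ⧸ Ideal.span {(X i : MvPowerSeries (Fin n) κ), F}) := by
  intro hfin
  -- two further distinct variables `u_j`, `u_l`
  obtain ⟨j, hj, l, hl, hjl⟩ : ∃ j ∈ Finset.univ.erase i, ∃ l ∈ Finset.univ.erase i, j ≠ l := by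
    rw [← Finset.one_lt_card, Finset.card_erase_of_mem (Finset.mem_univ i), Finset.card_univ,
      Fintype.card_fin]
    omega
  have hji : j ≠ i := Finset.ne_of_mem_erase hj
  have hli : l ≠ i := Finset.ne_of_mem_erase hl
  obtain ⟨r, hr⟩ := exists_X_pow_mem (Ideal.span {(X i : MvPowerSeries (Fin n) κ), F}) j
  obtain ⟨t, ht⟩ := exists_X_pow_mem (Ideal.span {(X i : MvPowerSeries (Fin n) κ), F}) l
  rw [Ideal.mem_span_pair] at hr ht
  obtain ⟨α, β, hαβ⟩ := hr
  obtain ⟨γ, δ, hγδ⟩ := ht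
  -- kill `u_i`
  have ha := hasSubst_kill (κ := κ) i
  have hai : subst (fun m : Fin n => if m = i then (0 : MvPowerSeries (Fin n) κ) else X m)
      (X i : MvPowerSeries (Fin n) κ) = 0 := by
    rw [subst_X ha, if_pos rfl]
  have haX : ∀ m, m ≠ i → subst (fun m : Fin n => if m = i then (0 : MvPowerSeries (Fin n) κ) else X m)
      (X m : MvPowerSeries (Fin n) κ) = X m := fun m hm => by
    rw [subst_X ha, if_neg hm]
  have hG : constantCoeff
      (subst (fun m : Fin n => if m = i then (0 : MvPowerSeries (Fin n) κ) else X m) F) = 0 :=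
    constantCoeff_subst_eq_zero ha (fun m => by
      split_ifs
      · exact map_zero _
      · exact constantCoeff_X _) hF
  have hj' := congrArg
    (subst (fun m : Fin n => if m = i then (0 : MvPowerSeries (Fin n) κ) else X m)) hαβ
  rw [subst_add ha, subst_mul ha, subst_mul ha, subst_pow ha, hai, haX j hji, mul_zero,
    zero_add] at hj'
  have hl' := congrArg
    (subst (fun m : Fin n => if m = i then (0 : MvPowerSeries (Fin n) κ) else X m)) hγδ
  rw [subst_add ha, subst_mul ha, subst_mul ha, subst_pow ha, hai, haX l hli, mul_zero,
    zero_add] at hl'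
  have hu := isUnit_of_X_pow_eq_mul hjl hj'.symm hl'.symm
  rw [isUnit_iff_constantCoeff, hG] at hu
  exact not_isUnit_zero hu

end CaseAExitOrdSucc

open MvPowerSeries in
/-- **Case A exit at cleaned order `p + 1`, `n ≥ 3`.** If the cleaned state has multiplicity `p`
but no monomial of degree `p` (cleaned order `≥ p + 1`), then an ISOLATED successor of the
point-blow-up dynamics is NOT of multiplicity `p`: the successor's series is `u_i · F`, its Jacobian
ideal lies in `(u_i, F)`, multiplicity `p` would force `F(0) = 0`, and `κ[[u]] ⧸ (u_i, F)` is then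
infinite over `κ`. (The hypothesis `OrdPSucc` is not needed.) [folklore] -/
theorem stub_caseAExitOrdSucc : ∀ p : ℕ, p.Prime → ∀ n : ℕ, 3 ≤ n → ∀ (κ : Type) [Field κ] [CharP κ p] [PerfectField κ] (c : (Fin n → ℕ) → κ) (i : Fin n) (τ : Fin n → κ), MultP p n κ c → ¬ OrdP p n κ c → OrdPSucc p n κ c → Isol p n κ (step p n κ i τ c) → ¬ MultP p n κ (step p n κ i τ c) := by
  intro p hp n hn κ _ _ _ c i τ hM hO _ hIsol hM'
  -- the cleaned order is `≥ p + 1`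
  have hord : ∀ A, clean p n κ c A ≠ 0 → p + 1 ≤ Finset.sum Finset.univ (fun j => A j) := by
    intro A hA
    rcases (hM.2 A hA).lt_or_eq with h | h
    · exact h
    · exact absurd ⟨A, hA, h.symm⟩ hO
  have hstep := OrdPExitSurface.step_eq i τ hM
  set g := dv n κ i p (bl n κ i (clean p n κ c))
  set h := tr n κ i τ p g
  -- every exponent in the support of the successor has a positive `u_i`-component
  have hsupp : ∀ B : Fin n → ℕ, clean p n κ h B ≠ 0 → 1 ≤ B i := by
    intro B hB
    obtain ⟨D, hDi, hgD⟩ := HighOrdNotIsol.exists_of_tr_ne_zero (g := g) (i := i) (τ := τ) (s := p)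
      (B := B) (HighOrdNotIsol.ne_zero_of_clean_ne_zero hB)
    obtain ⟨A, hA, hsum⟩ :=
      HighOrdNotIsol.exists_of_dv_bl_ne_zero (a := clean p n κ c) (i := i) (s := p) (B := B + D) hgD
    have := hord A hA
    rw [hsum, Pi.add_apply, hDi, add_zero] at this
    omega
  have hcoeff : ∀ B : Fin n →₀ ℕ, coeff B (ser p n κ (step p n κ i τ c)) = clean p n κ h ⇑B := by
    intro B
    show clean p n κ (step p n κ i τ c) ⇑B = _
    rw [hstep, CaseAExitOrdSucc.clean_clean]
  -- so `u_i` divides the successor's series: `ser b = u_i · F`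
  have hdvd : (X i : MvPowerSeries (Fin n) κ) ∣ ser p n κ (step p n κ i τ c) := by
    rw [X_dvd_iff]
    intro B hBi
    rw [hcoeff]
    by_contra hne
    have := hsupp ⇑B hne
    omega
  obtain ⟨F, hF⟩ := hdvd
  -- LEIBNIZ: the Jacobian ideal lies in `(u_i, F)`
  have hjac : jac p n κ (step p n κ i τ c) ≤ Ideal.span {(X i : MvPowerSeries (Fin n) κ), F} := by
    show Ideal.span (Set.range fun l => pd n κ l (ser p n κ (step p n κ i τ c))) ≤ _
    rw [Ideal.span_le, Set.range_subset_iff]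
    intro l
    rw [SetLike.mem_coe, CaseAExitOrdSucc.pd_eq, Ideal.mem_span_pair]
    refine ⟨Literature.RingTheory.MvPowerSeries.pd l F,
      Literature.RingTheory.MvPowerSeries.pd l (X i : MvPowerSeries (Fin n) κ), ?_⟩
    rw [hF, Literature.RingTheory.MvPowerSeries.pd_mul]
    ring
  -- hence `κ[[u]] ⧸ (u_i, F)` is finite over `κ`
  haveI : Module.Finite κ (MvPowerSeries (Fin n) κ ⧸ jac p n κ (step p n κ i τ c)) := hIsol
  have hfin : Module.Finite κ
      (MvPowerSeries (Fin n) κ ⧸ Ideal.span {(X i : MvPowerSeries (Fin n) κ), F}) :=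
    Module.Finite.of_surjective (Ideal.Quotient.factorₐ κ hjac).toLinearMap
      (Ideal.Quotient.factor_surjective hjac)
  -- multiplicity `p` of the successor kills the monomial `u_i`, i.e. `F(0) = 0`
  have hF0 : constantCoeff F = 0 := by
    rw [← CaseAExitOrdSucc.coeff_single_X_mul i F, ← hF]
    by_contra hne
    have h2 := hM'.2 (⇑(Finsupp.single i 1 : Fin n →₀ ℕ)) hne
    rw [Finsupp.univ_sum_single_apply] at h2
    have := hp.two_le
    omega
  exact CaseAExitOrdSucc.not_finite_quotient_span_pair hn i hF0 hfin

end Summit.ResolutionOfSingularities.ResolutionOfSingularities.Theorems.WildCones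

end
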